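import Summits.CriticalPhenomena.PercolationContinuityZ3.Theorems.PercNearOneGluingNoHeavyLowerTailSahiThreeCopyPairLiterals
import Summits.CriticalPhenomena.PercolationContinuityZ3.Theorems.PercNearOneGluingNoHeavyLowerTailSahiThreeCopyLiteralsIter

/-!
# `NoHeavyLowerTail` (crux stmt-CriticalPhenomena-4575), Sahi programme: **THE HALF-LITERAL STEP** — `UG(f, G¹) ⇒ UG(f ∧ x₀, G)` for an
# ARBITRARY monotone `G` on the bigger cube (only the member `f` carries the literal; `G` and the third function are free)

Support file (Sahi cell, seat `prim-sahi-p1`, generation 56; `--supports stmt-CriticalPhenomena-4575`).  COMPUTATIONAL only through the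
import of `…PairsClosure` (base `≤ 4`, used in §3); the theorems of §1–§2 use standard axioms.  Vocabulary: `andAdj` (`…Literals`),
`andAdjoin` (`…LiteralsIter`), `UGood` (`…Pairs`).

In `…PairLiterals` / `…PairOrLiterals` the fresh coordinate `x₀` enters BOTH members of the pair as a literal (or not at all).  Here it
enters the first member as an AND-literal and the second member `G : {0,1}^{d+1} → ℝ` ARBITRARILY (sections `G⁰ ≤ G¹`); the third function
`H` (sections `H⁰ ≤ H¹`) is free as always.  With `δ = G¹ − G⁰ ≥ 0`, `η = H¹ − H⁰ ≥ 0` (neither monotone) and `N = N_{b'}` on the old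
coordinates, the profile entries of `c_{(k,b')}(f ∧ x₀, G, H)` are EXACTLY (identities for all real data, found with the formal three-copy
algebra of memo FROM-prim-sahi-p1-gen56):
* `k = 0`: `0`;   `k = 3`: `c(f, G¹, H¹)`;
* `k = 1`: `c(f,G¹,H¹) + N(f; δ·H¹; 1) + [N(fH¹; 1; δ) − N(f; H¹; δ)] + N(f; G⁰η; 1) + [N(fG¹; 1; η) − N(f; G¹; η)] + N(f; δ; η)`;
* `k = 2`: `2c(f,G¹,H¹) + N(f; δ·H¹; 1) + N(f; G⁰η; 1) + [N(fH¹; 1; δ) − N(f; H¹; δ)] + [N(fG¹; 1; η) − N(f; G¹; η)]`.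
The brackets are three-copy Harris gaps WITH THE NON-MONOTONE SPECTATORS `δ`, `η` (`N3_le_N3_mul` only needs the spectator nonnegative),
the other terms are nonnegative outright.  Hence ★★ `tc_andAdj_free_nonneg` / `UGood.andAdj_free`: **if `(f, G¹)` is universally good then
so is `(f ∧ x₀, G)`** — the bottom section `G⁰` is irrelevant.  Iterating (§3, `uGood_andAdjoin_of_le_four`): for `f` on `d ≤ 4`
coordinates, **`(x₁ ∧ ⋯ ∧ x_m ∧ f, G)` is universally good for EVERY nonnegative monotone `G` on all `d + m` coordinates** — Kahn's
inequality `E₃(1_A,1_B,1_C) ≥ 0` (Bernstein-coefficientwise) for `A = x₁⋯x_m ∧ A'(y₁,…,y₄)` with `B` AND `C` ARBITRARY increasing events,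
a family with two free events.  (The analogous step with `x₀` entering `f` arbitrarily and `G` lifted has NO linear certificate: it
would specialise to a Harris-only proof of 3C-SAHI; memo §2.)  Nothing conjectural is used.  [this work]
-/

namespace Summit.CriticalPhenomena.PercolationContinuityZ3.Theorems.SahiThreeCopy

open Finset Function Literature.Combinatorics.Sahi2008
open scoped BigOperators

noncomputable section

variable {d : ℕ}

/-! ### §1 The half-literal AND step at every profile -/

/-- ★★ `c_b(f ∧ x₀, G, H) ≥ 0` for ARBITRARY nonnegative monotone `G, H` on `{0,1}^{d+1}`, given only `c_{b'}(f, G¹, H¹) ≥ 0` on the old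
coordinates (and `f ≥ 0` monotone).  Exact slice identities in the module docstring. [this work] -/
theorem tc_andAdj_free_nonneg (b : Fin (d + 1) → ℕ) {f : Pt d → ℝ} (hf : ∀ x, 0 ≤ f x) (hfm : Monotone f)
    {G : Pt (d + 1) → ℝ} (hG : ∀ w, 0 ≤ G w) (hGm : Monotone G) {H : Pt (d + 1) → ℝ} (hH : ∀ w, 0 ≤ H w) (hHm : Monotone H)
    (hfg : 0 ≤ tc (Fin.tail b) f (sec G true) (sec H true)) : 0 ≤ tc b (andAdj true f) G H := by
  have hb : b = Fin.cons (b 0) (Fin.tail b) := (Fin.cons_self_tail b).symm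
  set b' := Fin.tail b
  have hG0n : ∀ x, 0 ≤ (sec G false) x := sec_nonneg hG false
  have hG1n : ∀ x, 0 ≤ (sec G true) x := sec_nonneg hG true
  have hG1m : Monotone (sec G true) := sec_monotone hGm true
  have hG01 : ∀ x, (sec G false) x ≤ (sec G true) x := sec_false_le_sec_true hGm
  have hδ : ∀ x, 0 ≤ ((sec G true) - (sec G false)) x := fun x => sub_nonneg.2 (hG01 x)
  have hH0n : ∀ x, 0 ≤ (sec H false) x := sec_nonneg hH false
  have hH1n : ∀ x, 0 ≤ (sec H true) x := sec_nonneg hH true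
  have hH1m : Monotone (sec H true) := sec_monotone hHm true
  have hH01 : ∀ x, (sec H false) x ≤ (sec H true) x := sec_false_le_sec_true hHm
  have hη : ∀ x, 0 ≤ ((sec H true) - (sec H false)) x := fun x => sub_nonneg.2 (hH01 x)
  have one_nn : ∀ x : Pt d, (0 : ℝ) ≤ (1 : Pt d → ℝ) x := fun _ => zero_le_one
  -- the five nonnegative pieces
  have P1 : 0 ≤ N3 b' f ((sec G true - sec G false) * sec H true) 1 :=
    N3_nonneg b' hf (fun x => mul_nonneg (hδ x) (hH1n x)) one_nn
  have P2 : 0 ≤ N3 b' f (sec G false * (sec H true - sec H false)) 1 :=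
    N3_nonneg b' hf (fun x => mul_nonneg (hG0n x) (hη x)) one_nn
  have P3 : 0 ≤ N3 b' f (sec G true - sec G false) (sec H true - sec H false) := N3_nonneg b' hf hδ hη
  have A1 : N3 b' f (sec H true) (sec G true - sec G false) ≤ N3 b' (f * sec H true) 1 (sec G true - sec G false) :=
    N3_le_N3_mul d b' f (sec H true) (sec G true - sec G false) hf hfm hH1n hH1m hδ
  have A2 : N3 b' f (sec G true) (sec H true - sec H false) ≤ N3 b' (f * sec G true) 1 (sec H true - sec H false) :=
    N3_le_N3_mul d b' f (sec G true) (sec H true - sec H false) hf hfm hG1n hG1m hη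
  -- bridges
  have e1 : N3 b' f (sec H true) (sec G true) = N3 b' f (sec G true) (sec H true) := N3_comm23 b' f (sec H true) (sec G true)
  have e2 : N3 b' f (sec H true) (sec G false) = N3 b' f (sec G false) (sec H true) := N3_comm23 b' f (sec H true) (sec G false)
  have e3 : N3 b' (f * sec H true) 1 (sec G true) = N3 b' (sec G true) (f * sec H true) 1 := by rw [N3_comm13, N3_comm23]
  have e4 : N3 b' (f * sec H true) 1 (sec G false) = N3 b' (sec G false) (f * sec H true) 1 := by rw [N3_comm13, N3_comm23]
  have e5 : N3 b' (f * sec G true) 1 (sec H true) = N3 b' (sec H true) (f * sec G true) 1 := by rw [N3_comm13, N3_comm23]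
  have e6 : N3 b' (f * sec G true) 1 (sec H false) = N3 b' (sec H false) (f * sec G true) 1 := by rw [N3_comm13, N3_comm23]
  simp only [mul_sub, sub_mul, N3_sub_mid, N3_sub_right] at P1 P2 P3 A1 A2
  rw [hb]
  match hk : b 0 with
  | 0 =>
    rw [tc_cons_zero, sec_andAdj_true_false, tc_zero_left]
  | 1 =>
    rw [tc_cons_one]
    simp only [sec_andAdj_true_true, sec_andAdj_true_false, tc_zero_left, sub_zero, zero_mul, N3_zero_left, mul_zero,
      add_zero]
    unfold tc at hfg ⊢
    simp only [mul_sub, sub_mul, N3_sub_left, N3_sub_mid]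
    linarith [hfg, P1, P2, P3, A1, A2, e1, e2, e3, e4, e5, e6]
  | 2 =>
    rw [tc_cons_two]
    simp only [sec_andAdj_true_true, sec_andAdj_true_false, tc_zero_left, sub_zero, zero_mul, N3_zero_left, mul_zero,
      sub_zero, zero_add]
    unfold tc at hfg ⊢
    simp only [mul_sub, sub_mul, N3_sub_left, N3_sub_mid]
    linarith [hfg, P1, P2, A1, A2, e1, e2, e3, e4, e5, e6]
  | 3 =>
    rw [tc_cons_three, sec_andAdj_true_true]
    exact hfg
  | k + 4 =>
    rw [tc_cons_add_four]

/-! ### §2 Universally good pairs -/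

/-- ★★ **The half-literal step**: if `(f, G¹)` is universally good and `G` is nonnegative monotone, then `(f ∧ x₀, G)` is universally
good — `x₀` enters the second member ARBITRARILY. [this work] -/
theorem UGood.andAdj_free {f : Pt d → ℝ} {G : Pt (d + 1) → ℝ} (h : UGood f (sec G true)) (hG : ∀ w, 0 ≤ G w) (hGm : Monotone G) :
    UGood (SahiThreeCopy.andAdj true f) G :=
  ⟨andAdj_nonneg true h.1, hG, andAdj_monotone true h.1 h.2.2.1, hGm, fun b _ hH hHm =>
    tc_andAdj_free_nonneg b h.1 h.2.2.1 hG hGm hH hHm (h.2.2.2.2 _ _ (sec_nonneg hH true) (sec_monotone hHm true))⟩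

/-- The same with the literal on the second member: `UG(F¹, g) ⇒ UG(F, g ∧ x₀)`. [this work] -/
theorem UGood.andAdj_free_right {F : Pt (d + 1) → ℝ} {g : Pt d → ℝ} (h : UGood (sec F true) g) (hF : ∀ w, 0 ≤ F w)
    (hFm : Monotone F) : UGood F (SahiThreeCopy.andAdj true g) :=
  (h.symm.andAdj_free hF hFm).symm

/-- Events form: for up-sets `A ⊆ {0,1}^d` and `B ⊆ {0,1}^{d+1}`, if `(1_A, 1_{B¹})` is universally good (`B¹` the top section) then for
every up-set `C ⊆ {0,1}^{d+1}` and every profile, `0 ≤ c_b(1_A ∧ x₀, 1_B, 1_C)`. [this work] -/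
theorem tc_andAdj_free_setInd_nonneg (b : Fin (d + 1) → ℕ) {f : Pt d → ℝ} {B C : Finset (Pt (d + 1))}
    (hB : IsUpperSet (B : Set (Pt (d + 1)))) (hC : IsUpperSet (C : Set (Pt (d + 1)))) (h : UGood f (sec (setInd B) true)) :
    0 ≤ tc b (SahiThreeCopy.andAdj true f) (setInd B) (setInd C) :=
  (h.andAdj_free (setInd_nonneg B) (monotone_setInd hB)).2.2.2.2 b (setInd C) (setInd_nonneg C) (monotone_setInd hC)

/-! ### §3 Iteration from the settled base: a monomial of fresh literals AND-ed to a function on `≤ 4` coordinates, against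
ARBITRARY `G` -/

/-- ★★ For `f ≥ 0` monotone on `d ≤ 4` coordinates and EVERY nonnegative monotone `G` on all `d + m` coordinates, the pair
`(x₁ ∧ ⋯ ∧ x_m ∧ f, G)` (`andAdjoin m (fun _ => true) f`) is universally good: `c_b(x₁⋯x_m·f, G, H) ≥ 0` for all profiles and all
nonnegative monotone `H` — Kahn's inequality for `A = x₁⋯x_m ∧ A'(y₁..y₄)` with `B, C` ARBITRARY increasing events. [this work] -/
theorem uGood_andAdjoin_of_le_four (hd : d ≤ 4) {f : Pt d → ℝ} (hf : ∀ x, 0 ≤ f x) (hfm : Monotone f) :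
    ∀ (m : ℕ) {G : Pt (d + m) → ℝ}, (∀ w, 0 ≤ G w) → Monotone G → UGood (andAdjoin m (fun _ => true) f) G
  | 0, _, hG, hGm => uGood_of_le_four hd hf hfm hG hGm
  | m + 1, G, hG, hGm => by
    have ih := uGood_andAdjoin_of_le_four hd hf hfm m (G := sec G true) (sec_nonneg hG true) (sec_monotone hGm true)
    exact ih.andAdj_free hG hGm

/-- Law-level form of the previous theorem: `E₃^{coin q}(x₁⋯x_m·f, G, H) ≥ 0` under every product measure. [this work] -/
theorem sahiE_three_coin_andAdjoin_nonneg (hd : d ≤ 4) {f : Pt d → ℝ} (hf : ∀ x, 0 ≤ f x) (hfm : Monotone f) (m : ℕ)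
    {G H : Pt (d + m) → ℝ} (hG : ∀ w, 0 ≤ G w) (hGm : Monotone G) (hH : ∀ w, 0 ≤ H w) (hHm : Monotone H)
    {q : Fin (d + m) → ℝ} (hq : ∀ i, 0 ≤ q i ∧ q i ≤ 1) :
    0 ≤ sahiE (coinWeight q) 3 ![andAdjoin m (fun _ => true) f, G, H] :=
  sahiE_three_coin_nonneg_of_tc hq fun b => (uGood_andAdjoin_of_le_four hd hf hfm m hG hGm).2.2.2.2 b H hH hHm

end

end Summit.CriticalPhenomena.PercolationContinuityZ3.Theorems.SahiThreeCopy
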